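import Literature.Probability.RandomPlanarGeometry.SAWStripTMInvAdv
import HarnessLib

/-!
# The invariant of the enriched strip transfer matrix, III: the remaining `advance` cases (soundness, part 7)

Topic `Literature/Probability/RandomPlanarGeometry` (soundness of `SAWStripTM.lean`, part 7;
continues `SAWStripTMInvAdv.lean`): the sink abandonment (`stop (col k)`/no edge), the arrival at
the start cell through a vertical edge (`stop (col k)`/edge/start), and the dispatcher
`inv_advance` over all cases of `advance`.

## References

* I. Jensen, J. Phys. A 37 (2004) 11521–11529, §2.1.
* D. E. Knuth, TAOCP 4A (2011), §7.1.4.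
-/

namespace Literature.Probability.RandomPlanarGeometry.SAW

namespace StripTM

variable {l r0 : ℕ} {cs : List Bool} {u : ℕ} {σ σ' : State} {S : List (List XCell)}

/-- Lookups in a doubly updated code list. [folklore] -/
theorem getElem?_set_set {L : List Code} {i j k : ℕ} (hi : i < L.length) (hj : j < L.length) (hij : i ≠ j)
    (a b : Code) :
    ((L.set i a).set j b)[k]? = if k = j then some b else if k = i then some a else L[k]? := by
  have _ := hij
  by_cases hkj : k = j
  · subst hkj; rw [if_pos rfl, List.getElem?_set_self (by rw [List.length_set]; exact hj)]
  · rw [if_neg hkj, List.getElem?_set_ne (Ne.symm hkj)]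
    by_cases hki : k = i
    · subst hki; rw [if_pos rfl, List.getElem?_set_self hi]
    · rw [if_neg hki, List.getElem?_set_ne (Ne.symm hki)]

/-- **Case `stop (col k₀)`/no edge of `advance`**: the cell below is abandoned with degree one,
so it becomes the end of the bridge (the virtual sink is attached) and its far end now sees the
sink. [cite: Jensen2004SAWLowerBounds, §2.1] -/
theorem inv_advance_stop_false (hl : 2 ≤ l) (hu : u % 2 = 0) (hI : Inv l r0 cs u σ S) {k₀ : ℕ}
    (hcode : σ.slots[u / 2 % l]? = some (Code.stop (.col k₀))) (hcs : cs.getD u false = false)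
    (he : advance l r0 (u / 2) σ false = .next σ') :
    Inv l r0 cs (u + 1) σ' (gAdvance l r0 (u / 2) σ S false) := by
  have hl0 : 0 < l := by omega
  have hc : u / 2 % l < l := Nat.mod_lt _ hl0
  have hcs' : u / 2 % l < σ.slots.length := by rw [hI.len_slots]; exact hc
  have hk0 : k₀ < l := hI.mate_lt _ _ hcode
  have hk0' : k₀ < σ.slots.length := by rw [hI.len_slots]; exact hk0
  rw [advance_stop_col_false l r0 hcode] at he
  by_cases hcond : u / 2 % l + 1 = l ∧ σ.sink = false
  swap
  · rw [if_neg hcond] at he; cases he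
  rw [if_pos hcond] at he
  obtain ⟨hcl, hsink⟩ := hcond
  have hsl : σ'.slots = (σ.slots.set k₀ (.stop .snk)).set (u / 2 % l)
      (if isStart l r0 (u / 2) then .stop .src else .empty) := by cases he; rfl
  have hga : σ'.gaps = σ.gaps := by cases he; rfl
  have hsi : σ'.sink = true := by cases he; rfl
  rw [gAdvance_stop_false l r0 S hcode]
  -- the family: attach the sink below
  have hdf : below l (u / 2) = front l u (u / 2 % l) := below_eq_front hu
  have hvnot : cellOf l (u / 2) ∉ cells S := fun h => not_processed_cellOf hu hl0 (hI.processed _ h)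
  have hA := adj_symm l r0
  have hdreal : (below l (u / 2)).IsReal := by simp [below, XCell.IsReal]
  have hdb : (below l (u / 2), front l u k₀) ∈ endPairs S :=
    (hI.ends _ _ hdreal).2 ⟨_, hc, _, hcode, hdf, rfl⟩
  have hvsnk : XCell.vsnk ∉ cells S := by rw [hI.vsnk_mem, hsink]; simp
  obtain ⟨hW2, h2le2, hcells2, hpairs2, hends2⟩ :=
    extend_spec hI.wf hA hI.two_le hdb hdreal hvsnk (adj_below_vsnk hcl)
  have hbd_ne : front l u k₀ ≠ below l (u / 2) := (ne_of_mem_endPairs' hI.wf hI.two_le hdb).symm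
  have hk0c : k₀ ≠ u / 2 % l := by rintro rfl; exact hbd_ne hdf.symm
  have hfar : ∀ a, (a, below l (u / 2)) ∈ endPairs S → a = front l u k₀ := fun a h =>
    hI.wf.endPairs_unique (endPairs_symm h) hdb
  have hbd_mem : front l u k₀ ∈ cells S := mem_cells_of_mem_endPairs (endPairs_symm hdb)
  -- reindexed old end pairs away from the two strands' ends
  have hends_old : ∀ a b, a.IsReal → (((a, b) ∈ endPairs S ∧ a ≠ below l (u / 2) ∧ a ≠ front l u k₀) ↔
      ∃ k < l, ∃ m, k ≠ u / 2 % l ∧ k ≠ k₀ ∧ σ.slots[k]? = some (Code.stop m) ∧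
        a = front l (u + 1) k ∧ b = mateCell l (u + 1) m) := by
    intro a b ha
    constructor
    · rintro ⟨hab, hne1, hne2⟩
      obtain ⟨k, hk, m', hkm, rfl, rfl⟩ := (hI.ends a b ha).1 hab
      have hkc : k ≠ u / 2 % l := by rintro rfl; exact hne1 hdf.symm
      have hkk : k ≠ k₀ := by rintro rfl; exact hne2 rfl
      have hm' : ∀ j, m' = .col j → j ≠ u / 2 % l := by
        intro j hj e; subst hj; subst e
        apply hne2; apply hfar; simpa only [mateCell, ← hdf] using hab
      exact ⟨k, hk, m', hkc, hkk, hkm, (front_succ_of_ne hu hkc).symm, (mateCell_succ_of hu hm').symm⟩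
    · rintro ⟨k, hk, m', hkc, hkk, hkm, rfl, rfl⟩
      rw [front_succ_of_ne hu hkc]
      have ha' : (front l u k).IsReal := by rw [front_succ_of_ne hu hkc] at ha; exact ha
      have hold := (hI.ends _ _ ha').2 ⟨k, hk, m', hkm, rfl, rfl⟩
      have hmc : m' ≠ .col (u / 2 % l) := by
        intro e; subst e
        have := hfar _ (by simpa only [mateCell, ← hdf] using hold)
        exact hkk (front_inj this)
      have hm' : ∀ j, m' = .col j → j ≠ u / 2 % l := by intro j hj e; subst hj; subst e; exact hmc rfl
      rw [mateCell_succ_of hu hm']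
      exact ⟨hold, by rw [hdf]; intro e; exact hkc (front_inj e), fun e => hkk (front_inj e)⟩
  by_cases hst : isStart l r0 (u / 2) = true
  · -- the current cell is the start cell as well
    rw [if_pos hst]
    simp only [hst, if_true] at hsl
    have hvsrc : XCell.vsrc ∉ cells (merge (S ++ [[.vsnk]]) (below l (u / 2)) .vsnk) := by
      rw [hcells2, Finset.mem_insert, hI.vsrc_mem, not_or]
      exact ⟨by simp, (src_time_of_start hu hl0 hst).2⟩
    have hvnot2 : cellOf l (u / 2) ∉ cells (merge (S ++ [[.vsnk]]) (below l (u / 2)) .vsnk) := by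
      rw [hcells2, Finset.mem_insert, not_or]; exact ⟨by simp [cellOf], hvnot⟩
    obtain ⟨hW3, h2le3, hcells3, hpairs3, hends3⟩ :=
      new2_spec hW2 hA h2le2 hvnot2 hvsrc (by simp [cellOf]) (adj_cellOf_vsrc hl0 hst)
    refine ⟨?_, ?_, ?_, hW3, h2le3, ?_, ?_, ?_, ?_, ?_, ?_, ?_, ?_⟩
    · rw [hsl, List.length_set, List.length_set, hI.len_slots]
    · rw [hga, hI.len_gaps]
    · intro k j h
      rw [hsl, getElem?_set_set hk0' hcs' hk0c] at h
      split_ifs at h with h1 h2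
      · simp at h
      · simp at h
      · exact hI.mate_lt k j h
    · intro x hx
      rw [hcells3, hcells2] at hx; simp only [Finset.mem_insert] at hx
      rcases hx with rfl | rfl | rfl | hx
      · exact (processed_succ_even hu hl0 _).2 (Or.inr rfl)
      · trivial
      · trivial
      · exact (processed_succ_even hu hl0 _).2 (Or.inl (hI.processed x hx))
    · intro a b ha
      rw [hends3, hends2, hsl]
      constructor
      · rintro ((h | ⟨rfl, rfl⟩ | ⟨rfl, rfl⟩) | ⟨rfl, rfl⟩ | ⟨rfl, rfl⟩)
        · obtain ⟨k, hk, m', hkc, hkk, hkm, rfl, rfl⟩ := (hends_old a b ha).1 h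
          refine ⟨k, hk, m', ?_, rfl, rfl⟩
          rw [getElem?_set_set hk0' hcs' hk0c, if_neg hkc, if_neg hkk]; exact hkm
        · refine ⟨k₀, hk0, .snk, ?_, (front_succ_of_ne hu hk0c).symm, rfl⟩
          rw [getElem?_set_set hk0' hcs' hk0c, if_neg hk0c, if_pos rfl]
        · exact absurd ha (by simp [XCell.IsReal])
        · refine ⟨_, hc, .src, ?_, cellOf_eq_front_succ hu, rfl⟩
          rw [getElem?_set_set hk0' hcs' hk0c, if_pos rfl]
        · exact absurd ha (by simp [XCell.IsReal])
      · rintro ⟨k, hk, m', hkm, rfl, rfl⟩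
        rw [getElem?_set_set hk0' hcs' hk0c] at hkm
        split_ifs at hkm with h1 h2
        · subst h1; cases hkm
          exact Or.inr (Or.inl ⟨(cellOf_eq_front_succ hu).symm, rfl⟩)
        · subst h2; cases hkm
          exact Or.inl (Or.inr (Or.inl ⟨front_succ_of_ne hu hk0c, rfl⟩))
        · exact Or.inl (Or.inl ((hends_old _ _ ha).2 ⟨k, hk, m', h1, h2, hkm, rfl, rfl⟩))
    · intro k hk hk'
      rw [hsl, getElem?_set_set hk0' hcs' hk0c] at hk'
      split_ifs at hk' with h1 h2
      · simp at hk'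
      · simp at hk'
      · rw [front_succ_of_ne hu h1, hcells3, hcells2]
        simp only [Finset.mem_insert, not_or]
        obtain ⟨r', hr'⟩ := front_eq_cell (l := l) u k
        exact ⟨by rw [hr', cellOf]; intro e; cases e; exact h1 rfl, by rw [hr']; simp, by rw [hr']; simp,
          hI.empty k hk hk'⟩
    · intro k hk c' hk'
      rw [hsl, getElem?_set_set hk0' hcs' hk0c]
      split_ifs with h1 h2
      · exfalso; subst h1; rw [← cellOf_eq_front_succ hu, cellOf] at hk'; cases hk'
      · exfalso; subst h2
        rw [front_succ_of_ne hu hk0c] at hk'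
        have := hI.processed _ hbd_mem; rw [hk'] at this; exact absurd this.1 (by omega)
      · rw [front_succ_of_ne hu h1] at hk'; exact hI.dummy k hk c' hk'
    · rw [hcells3, hcells2]; simp only [Finset.mem_insert, cellOf, reduceCtorEq, false_or, true_or, or_true, true_iff]
      exact (src_time_of_start hu hl0 hst).1
    · rw [hcells3, hcells2, hsi]; simp [cellOf]
    · intro p
      rw [hpairs3, hpairs2, Nat.exists_lt_succ_right, hcs, Finset.mem_insert, Finset.mem_insert]
      simp only [Bool.false_eq_true, false_and, or_false]
      constructor
      · rintro ⟨rfl | rfl | hp, hreal⟩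
        · exact absurd (Sym2.ball.1 hreal).2 (by simp [XCell.IsReal])
        · exact absurd (Sym2.ball.1 hreal).2 (by simp [XCell.IsReal])
        · exact (hI.pairs_iff p).1 ⟨hp, hreal⟩
      · intro h; obtain ⟨hp, hreal⟩ := (hI.pairs_iff p).2 h; exact ⟨Or.inr (Or.inr hp), hreal⟩
    · intro k hk; rw [hga, hcount_succ_of_even hu]; exact hI.gaps_eq k hk
  · -- the current cell is fresh and unused
    have hst' : isStart l r0 (u / 2) = false := by simpa using hst
    rw [if_neg hst]
    simp only [hst', Bool.false_eq_true, if_false] at hsl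
    refine ⟨?_, ?_, ?_, hW2, h2le2, ?_, ?_, ?_, ?_, ?_, ?_, ?_, ?_⟩
    · rw [hsl, List.length_set, List.length_set, hI.len_slots]
    · rw [hga, hI.len_gaps]
    · intro k j h
      rw [hsl, getElem?_set_set hk0' hcs' hk0c] at h
      split_ifs at h with h1 h2
      · simp at h
      · simp at h
      · exact hI.mate_lt k j h
    · intro x hx
      rw [hcells2] at hx; simp only [Finset.mem_insert] at hx
      rcases hx with rfl | hx
      · trivial
      · exact (processed_succ_even hu hl0 _).2 (Or.inl (hI.processed x hx))
    · intro a b ha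
      rw [hends2, hsl]
      constructor
      · rintro (h | ⟨rfl, rfl⟩ | ⟨rfl, rfl⟩)
        · obtain ⟨k, hk, m', hkc, hkk, hkm, rfl, rfl⟩ := (hends_old a b ha).1 h
          refine ⟨k, hk, m', ?_, rfl, rfl⟩
          rw [getElem?_set_set hk0' hcs' hk0c, if_neg hkc, if_neg hkk]; exact hkm
        · refine ⟨k₀, hk0, .snk, ?_, (front_succ_of_ne hu hk0c).symm, rfl⟩
          rw [getElem?_set_set hk0' hcs' hk0c, if_neg hk0c, if_pos rfl]
        · exact absurd ha (by simp [XCell.IsReal])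
      · rintro ⟨k, hk, m', hkm, rfl, rfl⟩
        rw [getElem?_set_set hk0' hcs' hk0c] at hkm
        split_ifs at hkm with h1 h2
        · simp at hkm
        · subst h2; cases hkm
          exact Or.inr (Or.inl ⟨front_succ_of_ne hu hk0c, rfl⟩)
        · exact Or.inl ((hends_old _ _ ha).2 ⟨k, hk, m', h1, h2, hkm, rfl, rfl⟩)
    · intro k hk hk'
      rw [hsl, getElem?_set_set hk0' hcs' hk0c] at hk'
      split_ifs at hk' with h1 h2
      · subst h1; rw [← cellOf_eq_front_succ hu, hcells2, Finset.mem_insert, not_or]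
        exact ⟨by simp [cellOf], hvnot⟩
      · simp at hk'
      · rw [front_succ_of_ne hu h1, hcells2, Finset.mem_insert, not_or]
        obtain ⟨r', hr'⟩ := front_eq_cell (l := l) u k
        exact ⟨by rw [hr']; simp, hI.empty k hk hk'⟩
    · intro k hk c' hk'
      rw [hsl, getElem?_set_set hk0' hcs' hk0c]
      split_ifs with h1 h2
      · exfalso; subst h1; rw [← cellOf_eq_front_succ hu, cellOf] at hk'; cases hk'
      · exfalso; subst h2
        rw [front_succ_of_ne hu hk0c] at hk'
        have := hI.processed _ hbd_mem; rw [hk'] at this; exact absurd this.1 (by omega)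
      · rw [front_succ_of_ne hu h1] at hk'; exact hI.dummy k hk c' hk'
    · rw [hcells2, Finset.mem_insert, hI.vsrc_mem, src_time_succ_iff hu hl0 hst']; simp
    · rw [hcells2, hsi]; simp
    · intro p
      rw [hpairs2, Nat.exists_lt_succ_right, hcs, Finset.mem_insert]
      simp only [Bool.false_eq_true, false_and, or_false]
      constructor
      · rintro ⟨rfl | hp, hreal⟩
        · exact absurd (Sym2.ball.1 hreal).2 (by simp [XCell.IsReal])
        · exact (hI.pairs_iff p).1 ⟨hp, hreal⟩
      · intro h; obtain ⟨hp, hreal⟩ := (hI.pairs_iff p).2 h; exact ⟨Or.inr hp, hreal⟩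
    · intro k hk; rw [hga, hcount_succ_of_even hu]; exact hI.gaps_eq k hk

/-- **Case `stop (col k₀)`/edge of `advance` at the start cell**: the strand ending below is
extended by the start cell, to which the virtual source is attached; the far end now sees the
source. [cite: Jensen2004SAWLowerBounds, §2.1] -/
theorem inv_advance_stop_true_start (hl : 2 ≤ l) (hu : u % 2 = 0) (hI : Inv l r0 cs u σ S) {k₀ : ℕ}
    (hcode : σ.slots[u / 2 % l]? = some (Code.stop (.col k₀))) (hst : isStart l r0 (u / 2) = true)
    (hcs : cs.getD u false = true) (he : advance l r0 (u / 2) σ true = .next σ') :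
    Inv l r0 cs (u + 1) σ' (gAdvance l r0 (u / 2) σ S true) := by
  have hl0 : 0 < l := by omega
  have hc : u / 2 % l < l := Nat.mod_lt _ hl0
  have hcs' : u / 2 % l < σ.slots.length := by rw [hI.len_slots]; exact hc
  have hk0 : k₀ < l := hI.mate_lt _ _ hcode
  have hk0' : k₀ < σ.slots.length := by rw [hI.len_slots]; exact hk0
  rw [advance_stop_true_start l r0 hcode hst] at he
  have hsl : σ'.slots = (σ.slots.set (u / 2 % l) .inter).set k₀ (.stop .src) := by cases he; rfl
  have hga : σ'.gaps = σ.gaps := by cases he; rfl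
  have hsi : σ'.sink = σ.sink := by cases he; rfl
  rw [gAdvance_stop_true l r0 S hcode, if_pos hst]
  -- the family: extend, then attach the source
  have hdf : below l (u / 2) = front l u (u / 2 % l) := below_eq_front hu
  have hvnot : cellOf l (u / 2) ∉ cells S := fun h => not_processed_cellOf hu hl0 (hI.processed _ h)
  have hA := adj_symm l r0
  have hdreal : (below l (u / 2)).IsReal := by simp [below, XCell.IsReal]
  have hvreal : (cellOf l (u / 2)).IsReal := by simp [cellOf, XCell.IsReal]
  have hdb : (below l (u / 2), front l u k₀) ∈ endPairs S :=
    (hI.ends _ _ hdreal).2 ⟨_, hc, _, hcode, hdf, rfl⟩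
  obtain ⟨hW1, h2le1, hcells1, hpairs1, hends1⟩ :=
    extend_spec hI.wf hA hI.two_le hdb hdreal hvnot (adj_below_cellOf (u / 2))
  have hvsrc : XCell.vsrc ∉ cells (merge (S ++ [[cellOf l (u / 2)]]) (below l (u / 2)) (cellOf l (u / 2))) := by
    rw [hcells1, Finset.mem_insert, hI.vsrc_mem, not_or]
    exact ⟨by simp [cellOf], (src_time_of_start hu hl0 hst).2⟩
  have hvb : (cellOf l (u / 2), front l u k₀) ∈
      endPairs (merge (S ++ [[cellOf l (u / 2)]]) (below l (u / 2)) (cellOf l (u / 2))) :=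
    (hends1 _ _).2 (Or.inr (Or.inr ⟨rfl, rfl⟩))
  obtain ⟨hW2, h2le2, hcells2, hpairs2, hends2⟩ :=
    extend_spec hW1 hA h2le1 hvb hvreal hvsrc (adj_cellOf_vsrc hl0 hst)
  have hbd_ne : front l u k₀ ≠ below l (u / 2) := (ne_of_mem_endPairs' hI.wf hI.two_le hdb).symm
  have hk0c : k₀ ≠ u / 2 % l := by rintro rfl; exact hbd_ne hdf.symm
  have hck0 : u / 2 % l ≠ k₀ := Ne.symm hk0c
  have hfar : ∀ a, (a, below l (u / 2)) ∈ endPairs S → a = front l u k₀ := fun a h =>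
    hI.wf.endPairs_unique (endPairs_symm h) hdb
  have hbd_mem : front l u k₀ ∈ cells S := mem_cells_of_mem_endPairs (endPairs_symm hdb)
  have hends_old : ∀ a b, a.IsReal → (((a, b) ∈ endPairs S ∧ a ≠ below l (u / 2) ∧ a ≠ front l u k₀) ↔
      ∃ k < l, ∃ m, k ≠ u / 2 % l ∧ k ≠ k₀ ∧ σ.slots[k]? = some (Code.stop m) ∧
        a = front l (u + 1) k ∧ b = mateCell l (u + 1) m) := by
    intro a b ha
    constructor
    · rintro ⟨hab, hne1, hne2⟩
      obtain ⟨k, hk, m', hkm, rfl, rfl⟩ := (hI.ends a b ha).1 hab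
      have hkc : k ≠ u / 2 % l := by rintro rfl; exact hne1 hdf.symm
      have hkk : k ≠ k₀ := by rintro rfl; exact hne2 rfl
      have hm' : ∀ j, m' = .col j → j ≠ u / 2 % l := by
        intro j hj e; subst hj; subst e
        apply hne2; apply hfar; simpa only [mateCell, ← hdf] using hab
      exact ⟨k, hk, m', hkc, hkk, hkm, (front_succ_of_ne hu hkc).symm, (mateCell_succ_of hu hm').symm⟩
    · rintro ⟨k, hk, m', hkc, hkk, hkm, rfl, rfl⟩
      rw [front_succ_of_ne hu hkc]
      have ha' : (front l u k).IsReal := by rw [front_succ_of_ne hu hkc] at ha; exact ha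
      have hold := (hI.ends _ _ ha').2 ⟨k, hk, m', hkm, rfl, rfl⟩
      have hmc : m' ≠ .col (u / 2 % l) := by
        intro e; subst e
        have := hfar _ (by simpa only [mateCell, ← hdf] using hold)
        exact hkk (front_inj this)
      have hm' : ∀ j, m' = .col j → j ≠ u / 2 % l := by intro j hj e; subst hj; subst e; exact hmc rfl
      rw [mateCell_succ_of hu hm']
      exact ⟨hold, by rw [hdf]; intro e; exact hkc (front_inj e), fun e => hkk (front_inj e)⟩
  refine ⟨?_, ?_, ?_, hW2, h2le2, ?_, ?_, ?_, ?_, ?_, ?_, ?_, ?_⟩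
  · rw [hsl, List.length_set, List.length_set, hI.len_slots]
  · rw [hga, hI.len_gaps]
  · intro k j h
    rw [hsl, getElem?_set_set hcs' hk0' hck0] at h
    split_ifs at h with h1 h2
    · simp at h
    · simp at h
    · exact hI.mate_lt k j h
  · intro x hx
    rw [hcells2, hcells1] at hx; simp only [Finset.mem_insert] at hx
    rcases hx with rfl | rfl | hx
    · trivial
    · exact (processed_succ_even hu hl0 _).2 (Or.inr rfl)
    · exact (processed_succ_even hu hl0 _).2 (Or.inl (hI.processed x hx))
  · intro a b ha
    rw [hends2, hsl]
    simp only [hends1]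
    constructor
    · rintro (⟨h | ⟨rfl, rfl⟩ | ⟨rfl, rfl⟩, hne1, hne2⟩ | ⟨rfl, rfl⟩ | ⟨rfl, rfl⟩)
      · obtain ⟨k, hk, m', hkc, hkk, hkm, rfl, rfl⟩ := (hends_old a b ha).1 h
        refine ⟨k, hk, m', ?_, rfl, rfl⟩
        rw [getElem?_set_set hcs' hk0' hck0, if_neg hkk, if_neg hkc]; exact hkm
      · exact absurd rfl hne2
      · exact absurd rfl hne1
      · refine ⟨k₀, hk0, .src, ?_, (front_succ_of_ne hu hk0c).symm, rfl⟩
        rw [getElem?_set_set hcs' hk0' hck0, if_pos rfl]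
      · exact absurd ha (by simp [XCell.IsReal])
    · rintro ⟨k, hk, m', hkm, rfl, rfl⟩
      rw [getElem?_set_set hcs' hk0' hck0] at hkm
      split_ifs at hkm with h1 h2
      · subst h1; cases hkm
        exact Or.inr (Or.inl ⟨front_succ_of_ne hu hk0c, rfl⟩)
      · simp at hkm
      · have hold := (hends_old _ _ ha).2 ⟨k, hk, m', h2, h1, hkm, rfl, rfl⟩
        refine Or.inl ⟨Or.inl hold, ?_, fun e => h1 (front_inj (by rw [front_succ_of_ne hu h2] at e; exact e))⟩
        intro e; exact hvnot (e ▸ mem_cells_of_mem_endPairs hold.1)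
  · intro k hk hk'
    rw [hsl, getElem?_set_set hcs' hk0' hck0] at hk'
    split_ifs at hk' with h1 h2
    · simp at hk'
    · simp at hk'
    · rw [front_succ_of_ne hu h2, hcells2, hcells1]
      simp only [Finset.mem_insert, not_or]
      obtain ⟨r', hr'⟩ := front_eq_cell (l := l) u k
      exact ⟨by rw [hr']; simp, by rw [hr', cellOf]; intro e; cases e; exact h2 rfl, hI.empty k hk hk'⟩
  · intro k hk c' hk'
    rw [hsl, getElem?_set_set hcs' hk0' hck0]
    split_ifs with h1 h2
    · exfalso; subst h1
      rw [front_succ_of_ne hu hk0c] at hk'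
      have := hI.processed _ hbd_mem; rw [hk'] at this; exact absurd this.1 (by omega)
    · rfl
    · rw [front_succ_of_ne hu h2] at hk'; exact hI.dummy k hk c' hk'
  · rw [hcells2, hcells1]
    simp only [Finset.mem_insert, cellOf, reduceCtorEq, false_or, true_or, true_iff]
    exact (src_time_of_start hu hl0 hst).1
  · rw [hcells2, hcells1, hsi]
    simp only [Finset.mem_insert, cellOf, reduceCtorEq, false_or]
    exact hI.vsnk_mem
  · intro p
    rw [hpairs2, hpairs1, Nat.exists_lt_succ_right, potEdge_of_even hu, hcs, Finset.mem_insert, Finset.mem_insert]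
    simp only [true_and]
    constructor
    · rintro ⟨rfl | rfl | hp, hreal⟩
      · exact absurd (Sym2.ball.1 hreal).2 (by simp [XCell.IsReal])
      · exact Or.inr rfl
      · exact Or.inl ((hI.pairs_iff p).1 ⟨hp, hreal⟩)
    · rintro (h | rfl)
      · obtain ⟨hp, hreal⟩ := (hI.pairs_iff p).2 h; exact ⟨Or.inr (Or.inr hp), hreal⟩
      · exact ⟨Or.inr (Or.inl rfl), Sym2.ball.2 ⟨hdreal, hvreal⟩⟩
  · intro k hk; rw [hga, hcount_succ_of_even hu]; exact hI.gaps_eq k hk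

/-- **`advance` preserves the invariant** (all cases that continue the run).
[cite: Jensen2004SAWLowerBounds, §2.1] -/
theorem inv_advance (hl : 2 ≤ l) (hu : u % 2 = 0) (hI : Inv l r0 cs u σ S)
    (he : advance l r0 (u / 2) σ (cs.getD u false) = .next σ') :
    Inv l r0 cs (u + 1) σ' (gAdvance l r0 (u / 2) σ S (cs.getD u false)) := by
  have hl0 : 0 < l := by omega
  have hc : u / 2 % l < l := Nat.mod_lt _ hl0
  have hcs' : u / 2 % l < σ.slots.length := by rw [hI.len_slots]; exact hc
  obtain ⟨code, hcode⟩ : ∃ code, σ.slots[u / 2 % l]? = some code := ⟨_, List.getElem?_eq_getElem hcs'⟩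
  rcases Bool.eq_false_or_eq_true (cs.getD u false) with hcs | hcs <;> rw [hcs] at he ⊢
  · -- an edge from below
    cases code with
    | empty => exact inv_advance_empty_true hl hu hI hcode hcs he
    | inter => rw [advance_inter_true l r0 hcode] at he; cases he
    | stop m =>
      rcases Bool.eq_false_or_eq_true (isStart l r0 (u / 2)) with hst | hst
      · cases m with
        | col k₀ => exact inv_advance_stop_true_start hl hu hI hcode hst hcs he
        | src => rw [advance_stop_src_true_start l r0 hcode hst] at he; cases he
        | snk =>
          exfalso
          simp only [advance, hcode, Option.getD_some, hst, completeIf] at he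
          revert he; split_ifs <;> simp
      · exact inv_advance_stop_true hl hu hI hcode hst hcs he
  · -- no edge from below
    cases code with
    | empty => exact inv_advance_noedge hl hu hI (Or.inl hcode) hcs he
    | inter => exact inv_advance_noedge hl hu hI (Or.inr hcode) hcs he
    | stop m =>
      cases m with
      | col k₀ => exact inv_advance_stop_false hl hu hI hcode hcs he
      | src => exact absurd he (advance_stop_src_false_ne_next l r0 hcode)
      | snk => rw [advance_stop_snk_false l r0 hcode] at he; cases he

end StripTM

end Literature.Probability.RandomPlanarGeometry.SAW
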